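import Literature.Combinatorics.Optimization.TracialDesigns
import Literature.Combinatorics.Optimization.OddCutLevelSetsNonempty
import HarnessLib

/-!
# An explicit exact extrapolation design of bounded variation (`ChebyshevDesignExistsBal 20`)

`TracialDesigns.lean` names the statement `ChebyshevDesignExistsBal B`: for all large even `n` there
is a balanced exact extrapolation design of degree `D = dq n = ⌊⌊√n⌋^{1/2}⌋` on odd levels
`3 ≤ c ≤ T = Tq n = 4⌊√n⌋ + 3` for the `t`-cuts of `K_n`, of total variation `Σ_c |w_c| ≤ B` — the
regime `D² ≤ T/4` of bounded polynomial growth of Coppersmith–Rivlin [Coppersmith–Rivlin, *The growth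
of polynomials bounded at equally spaced points*, SIAM J. Math. Anal. 23 (1992), Thm. p. 970]. This
file PROVES `ChebyshevDesignExistsBal 20` by an explicit elementary construction (the cell's planner
note HOME/pnp-psdrank-p1/ROUND-3.md §2.12, PLAN-ChebyshevDesign20.md):

* nodes `c_j = 3 + 4 s j²`, `0 ≤ j ≤ D`, with `s = ⌊⌊√n⌋ / D²⌋ ≥ 1` (odd, distinct, `≤ T`, no rounding);
* weights `w_{c_j} = -ℓ_j(0)`, the Lagrange extrapolation coefficients to the virtual level `0`
  (exactness for `deg p ≤ D` is Lagrange interpolation, `Lagrange.eq_interpolate`; normalisation is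
  exactness for `p = X - 1`);
* variation: `|ℓ_j(0)| = ∏_{i ≠ j} (i² + ε) / |i² - j²|` with `ε = 3/(4s) ≤ 3/4`; the identity
  `(∏_{i ≠ j} i)² (D-j)! (D+j)! = 2 (D!)² ∏_{i ≠ j} |i-j| (i+j)` (over `1 ≤ i ≤ D`) and
  `(D!)² ≤ (D-j)! (D+j)!` give `∏_{i ≠ j, i ≥ 1} i²/|i²-j²| ≤ 2`, and `∏ (1 + ε/i²) ≤ e^{7ε/4}`, so
  `Σ_j |ℓ_j(0)| ≤ e^{7ε/4} (1 + 7ε/2) ≤ e^{21/16} · 29/8 < 14.5 ≤ 20` (`sum_L_le`);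
* `t` = the odd one of `n/2 - 1`, `n/2 - 2`; level classes `Q_c(t) ≠ ∅` by
  `qset_nonempty_of_two_mul_add_two_le` (`OddCutLevelSetsNonempty.lean`); `n₀ = 100`.

## References

* D. Coppersmith, T. J. Rivlin, *The growth of polynomials bounded at equally spaced points*,
  SIAM J. Math. Anal. 23 (1992) 970–983, Thm. (p. 970). [CoppersmithRivlin1992]
* T. Rothvoß, *The matching polytope has exponential extension complexity*, J. ACM 64 (2017), §2
  (the `t`-cuts and level sets `Q_c`). [Rothvoss2017]
-/

noncomputable section

open Finset Real Polynomial

namespace Literature.Combinatorics.Optimization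

namespace ChebyshevDesign


/-! ### The factorial identity behind `∏_{i ≠ j} i² / |i² - j²| = 2 (D!)² / ((D-j)! (D+j)!)` -/

section Factorial

variable {D j : ℕ}

/-- Splitting `{1..D} ∖ {j}` at `j`.
[cite: CoppersmithRivlin1992, Thm. (p. 970); elementary Lagrange-extrapolation instance] -/
theorem erase_Ico_eq (hj : 1 ≤ j) (hjD : j ≤ D) :
    (Ico 1 (D + 1)).erase j = Ico 1 j ∪ Ico (j + 1) (D + 1) := by
  ext i
  simp only [mem_erase, mem_Ico, mem_union]
  omega

/-- The two halves are disjoint.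
[cite: CoppersmithRivlin1992, Thm. (p. 970); elementary Lagrange-extrapolation instance] -/
theorem disjoint_Ico_Ico_succ : Disjoint (Ico 1 j) (Ico (j + 1) (D + 1)) := by
  rw [Finset.disjoint_left]
  intro i hi hi'
  rw [mem_Ico] at hi hi'
  omega

/-- `j · ∏_{1 ≤ i ≤ D, i ≠ j} i = D!`.
[cite: CoppersmithRivlin1992, Thm. (p. 970); elementary Lagrange-extrapolation instance] -/
theorem mul_prod_erase_id (hj : 1 ≤ j) (hjD : j ≤ D) :
    j * ∏ i ∈ (Ico 1 (D + 1)).erase j, i = D.factorial := by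
  have hmem : j ∈ Ico 1 (D + 1) := mem_Ico.2 ⟨hj, Nat.lt_succ_of_le hjD⟩
  have h := mul_prod_erase (Ico 1 (D + 1)) (fun i => i) hmem
  rw [h, prod_Ico_id_eq_factorial]

/-- `∏_{1 ≤ i ≤ D, i ≠ j} |i - j| = (j-1)! (D-j)!`.
[cite: CoppersmithRivlin1992, Thm. (p. 970); elementary Lagrange-extrapolation instance] -/
theorem prod_erase_dist (hj : 1 ≤ j) (hjD : j ≤ D) :
    ∏ i ∈ (Ico 1 (D + 1)).erase j, Nat.dist i j = (j - 1).factorial * (D - j).factorial := by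
  rw [erase_Ico_eq hj hjD, prod_union disjoint_Ico_Ico_succ]
  congr 1
  · rw [prod_Ico_eq_prod_range]
    have h1 : ∀ m ∈ range (j - 1), Nat.dist (1 + m) j = (j - 1 - 1 - m) + 1 := by
      intro m hm
      rw [mem_range] at hm
      rw [Nat.dist_eq_sub_of_le (by omega)]
      omega
    rw [prod_congr rfl h1, prod_range_reflect (fun m => m + 1) (j - 1), prod_range_add_one_eq_factorial]
  · rw [prod_Ico_eq_prod_range]
    have h2 : D + 1 - (j + 1) = D - j := by omega
    have h1 : ∀ m ∈ range (D + 1 - (j + 1)), Nat.dist (j + 1 + m) j = m + 1 := by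
      intro m _
      rw [Nat.dist_eq_sub_of_le_right (by omega)]
      omega
    rw [prod_congr rfl h1, h2, prod_range_add_one_eq_factorial]

/-- `j! · 2j · ∏_{1 ≤ i ≤ D, i ≠ j} (i + j) = (D+j)!`.
[cite: CoppersmithRivlin1992, Thm. (p. 970); elementary Lagrange-extrapolation instance] -/
theorem mul_prod_erase_add (hj : 1 ≤ j) (hjD : j ≤ D) :
    j.factorial * (2 * j) * ∏ i ∈ (Ico 1 (D + 1)).erase j, (i + j) = (D + j).factorial := by
  have hmem : j ∈ Ico 1 (D + 1) := mem_Ico.2 ⟨hj, Nat.lt_succ_of_le hjD⟩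
  have h := mul_prod_erase (Ico 1 (D + 1)) (fun i => i + j) hmem
  have hall : ∏ i ∈ Ico 1 (D + 1), (i + j) = (j + 1).ascFactorial D := by
    rw [prod_Ico_eq_prod_range, Nat.ascFactorial_eq_prod_range, Nat.add_sub_cancel]
    exact prod_congr rfl fun m _ => by ring
  rw [mul_assoc, two_mul, h, hall, Nat.factorial_mul_ascFactorial, add_comm]

/-- **The identity** `(∏ i)² (D-j)! (D+j)! = 2 (D!)² ∏ |i-j| (i+j)` over `1 ≤ i ≤ D`, `i ≠ j`.
[cite: CoppersmithRivlin1992, Thm. (p. 970); elementary Lagrange-extrapolation instance] -/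
theorem key_identity (hj : 1 ≤ j) (hjD : j ≤ D) :
    (∏ i ∈ (Ico 1 (D + 1)).erase j, i) ^ 2 * ((D - j).factorial * (D + j).factorial) =
      2 * D.factorial ^ 2 * ∏ i ∈ (Ico 1 (D + 1)).erase j, (Nat.dist i j * (i + j)) := by
  rw [prod_mul_distrib, prod_erase_dist hj hjD, ← mul_prod_erase_id hj hjD,
    ← mul_prod_erase_add hj hjD]
  obtain ⟨k, rfl⟩ : ∃ k, j = k + 1 := ⟨j - 1, by omega⟩
  rw [Nat.add_sub_cancel, Nat.factorial_succ]
  ring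

/-- `(D!)² ≤ (D-j)! (D+j)!` (the central binomial coefficient is the largest).
[cite: CoppersmithRivlin1992, Thm. (p. 970); elementary Lagrange-extrapolation instance] -/
theorem factorial_sq_le (hjD : j ≤ D) :
    D.factorial ^ 2 ≤ (D - j).factorial * (D + j).factorial := by
  have h1 : (D - j).factorial * D.descFactorial j = D.factorial := Nat.factorial_mul_descFactorial hjD
  have h2 : D.factorial * (D + 1).ascFactorial j = (D + j).factorial := Nat.factorial_mul_ascFactorial D j
  have h3 : D.descFactorial j ≤ (D + 1).ascFactorial j :=
    (Nat.descFactorial_le_pow D j).trans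
      ((Nat.pow_le_pow_left (Nat.le_succ D) j).trans (Nat.pow_succ_le_ascFactorial (D + 1) j))
  calc D.factorial ^ 2 = (D - j).factorial * D.descFactorial j * D.factorial := by rw [h1, sq]
    _ ≤ (D - j).factorial * (D + 1).ascFactorial j * D.factorial := by gcongr
    _ = (D - j).factorial * (D + j).factorial := by rw [mul_assoc, mul_comm (Nat.ascFactorial _ _), h2]

/-- Consequence: `(∏ i)² ≤ 2 ∏ |i-j| (i+j)`.
[cite: CoppersmithRivlin1992, Thm. (p. 970); elementary Lagrange-extrapolation instance] -/
theorem prod_sq_le_two_mul (hj : 1 ≤ j) (hjD : j ≤ D) :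
    (∏ i ∈ (Ico 1 (D + 1)).erase j, i) ^ 2 ≤ 2 * ∏ i ∈ (Ico 1 (D + 1)).erase j, (Nat.dist i j * (i + j)) := by
  have hpos : 0 < (D - j).factorial * (D + j).factorial :=
    Nat.mul_pos (Nat.factorial_pos _) (Nat.factorial_pos _)
  have h : (∏ i ∈ (Ico 1 (D + 1)).erase j, i) ^ 2 * ((D - j).factorial * (D + j).factorial) ≤
      (2 * ∏ i ∈ (Ico 1 (D + 1)).erase j, (Nat.dist i j * (i + j))) *
        ((D - j).factorial * (D + j).factorial) := by
    rw [key_identity hj hjD]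
    calc 2 * D.factorial ^ 2 * ∏ i ∈ (Ico 1 (D + 1)).erase j, (Nat.dist i j * (i + j))
        ≤ 2 * ((D - j).factorial * (D + j).factorial) *
            ∏ i ∈ (Ico 1 (D + 1)).erase j, (Nat.dist i j * (i + j)) := by
          gcongr
          exact factorial_sq_le hjD
      _ = _ := by ring
  exact Nat.le_of_mul_le_mul_right h hpos

end Factorial

/-! ### The nodes and the variation bound -/

section Real

/-- The real node `3 + 4 s i²`.
[cite: CoppersmithRivlin1992, Thm. (p. 970); elementary Lagrange-extrapolation instance] -/
def node (s : ℝ) (i : ℕ) : ℝ := 3 + 4 * s * (i : ℝ) ^ 2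

/-- `ε = 3 / (4s)`.
[cite: CoppersmithRivlin1992, Thm. (p. 970); elementary Lagrange-extrapolation instance] -/
def eps (s : ℝ) : ℝ := 3 / (4 * s)

/-- `|ℓ_j(0)|` as a product: `L_j = ∏_{i ≤ D, i ≠ j} v_i / |v_i - v_j|`.
[cite: CoppersmithRivlin1992, Thm. (p. 970); elementary Lagrange-extrapolation instance] -/
def L (D : ℕ) (s : ℝ) (j : ℕ) : ℝ := ∏ i ∈ (range (D + 1)).erase j, node s i / |node s i - node s j|

variable {s : ℝ}

/-- `v_i = 4s (i² + ε)`.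
[cite: CoppersmithRivlin1992, Thm. (p. 970); elementary Lagrange-extrapolation instance] -/
theorem node_eq (hs : 0 < s) (i : ℕ) : node s i = 4 * s * ((i : ℝ) ^ 2 + eps s) := by
  rw [node, eps]; field_simp; ring

/-- The nodes are positive.
[cite: CoppersmithRivlin1992, Thm. (p. 970); elementary Lagrange-extrapolation instance] -/
theorem node_pos (hs : 0 < s) (i : ℕ) : 0 < node s i := by
  rw [node]; positivity

/-- `ε > 0`.
[cite: CoppersmithRivlin1992, Thm. (p. 970); elementary Lagrange-extrapolation instance] -/
theorem eps_pos (hs : 0 < s) : 0 < eps s := by rw [eps]; positivity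

/-- `ε ≤ 3/4` for `s ≥ 1`.
[cite: CoppersmithRivlin1992, Thm. (p. 970); elementary Lagrange-extrapolation instance] -/
theorem eps_le (hs : 1 ≤ s) : eps s ≤ 3 / 4 := by
  rw [eps, div_le_div_iff₀ (by linarith) (by norm_num)]; linarith

/-- The factors `4s` cancel: `v_i / |v_i - v_j| = (i² + ε) / |i² - j²|`.
[cite: CoppersmithRivlin1992, Thm. (p. 970); elementary Lagrange-extrapolation instance] -/
theorem node_div (hs : 0 < s) (i j : ℕ) :
    node s i / |node s i - node s j| = ((i : ℝ) ^ 2 + eps s) / |(i : ℝ) ^ 2 - (j : ℝ) ^ 2| := by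
  rw [node_eq hs, node_eq hs, ← mul_sub, abs_mul, abs_of_pos (by linarith : (0 : ℝ) < 4 * s)]
  have h4 : (4 : ℝ) * s ≠ 0 := by positivity
  rw [add_sub_add_right_eq_sub, mul_div_mul_left _ _ h4]

/-- `|i² - j²| = |i - j| (i + j)` with `|i - j| = Nat.dist i j`.
[cite: CoppersmithRivlin1992, Thm. (p. 970); elementary Lagrange-extrapolation instance] -/
theorem abs_sq_sub_sq (i j : ℕ) :
    |(i : ℝ) ^ 2 - (j : ℝ) ^ 2| = (Nat.dist i j : ℝ) * ((i : ℝ) + j) := by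
  rw [sq_sub_sq, abs_mul, abs_of_nonneg (by positivity : (0 : ℝ) ≤ i + j), mul_comm]
  congr 1
  rcases le_total i j with h | h
  · rw [Nat.dist_eq_sub_of_le h, Nat.cast_sub h, abs_sub_comm, abs_of_nonneg (by
      rw [sub_nonneg]; exact_mod_cast h)]
  · rw [Nat.dist_eq_sub_of_le_right h, Nat.cast_sub h, abs_of_nonneg (by
      rw [sub_nonneg]; exact_mod_cast h)]

/-- The `E`-product `∏_{1 ≤ i ≤ D} (1 + ε / i²)`.
[cite: CoppersmithRivlin1992, Thm. (p. 970); elementary Lagrange-extrapolation instance] -/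
def E (D : ℕ) (s : ℝ) : ℝ := ∏ i ∈ Ico 1 (D + 1), (1 + eps s / (i : ℝ) ^ 2)

/-- `1 ≤ 1 + ε/i²`.
[cite: CoppersmithRivlin1992, Thm. (p. 970); elementary Lagrange-extrapolation instance] -/
theorem one_le_factor (hs : 0 < s) (i : ℕ) : 1 ≤ 1 + eps s / (i : ℝ) ^ 2 :=
  le_add_of_nonneg_right (div_nonneg (eps_pos hs).le (sq_nonneg _))

/-- `E > 0`.
[cite: CoppersmithRivlin1992, Thm. (p. 970); elementary Lagrange-extrapolation instance] -/
theorem E_pos (hs : 0 < s) (D : ℕ) : 0 < E D s :=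
  prod_pos fun i _ => lt_of_lt_of_le one_pos (one_le_factor hs i)

/-- `L_0 = E`.
[cite: CoppersmithRivlin1992, Thm. (p. 970); elementary Lagrange-extrapolation instance] -/
theorem L_zero (hs : 0 < s) (D : ℕ) : L D s 0 = E D s := by
  rw [L, E]
  have h : (range (D + 1)).erase 0 = Ico 1 (D + 1) := by
    ext i; simp only [mem_erase, mem_range, mem_Ico]; omega
  rw [h]
  refine prod_congr rfl fun i hi => ?_
  have hi1 : (1 : ℝ) ≤ i := by exact_mod_cast (mem_Ico.1 hi).1
  rw [node_div hs, Nat.cast_zero, zero_pow two_ne_zero, sub_zero, abs_of_pos (by positivity),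
    add_div, div_self (by positivity)]

/-- `L_j = (ε / j²) · ∏_{1 ≤ i ≤ D, i ≠ j} (i² + ε) / |i² - j²|` for `1 ≤ j`.
[cite: CoppersmithRivlin1992, Thm. (p. 970); elementary Lagrange-extrapolation instance] -/
theorem L_succ (hs : 0 < s) {D j : ℕ} (hj : 1 ≤ j) (hjD : j ≤ D) :
    L D s j = eps s / (j : ℝ) ^ 2 *
      ∏ i ∈ (Ico 1 (D + 1)).erase j, ((i : ℝ) ^ 2 + eps s) / |(i : ℝ) ^ 2 - (j : ℝ) ^ 2| := by
  rw [L]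
  have h : (range (D + 1)).erase j = insert 0 ((Ico 1 (D + 1)).erase j) := by
    ext i; simp only [mem_erase, mem_range, mem_insert, mem_Ico]; omega
  have h0 : (0 : ℕ) ∉ (Ico 1 (D + 1)).erase j := by simp
  rw [h, prod_insert h0, node_div hs]
  congr 1
  · rw [Nat.cast_zero, zero_pow two_ne_zero, zero_add, zero_sub, abs_neg, abs_of_pos (by positivity)]
  · exact prod_congr rfl fun i _ => node_div hs i j

/-- The inner product is at most `2 E` (the factorial identity).
[cite: CoppersmithRivlin1992, Thm. (p. 970); elementary Lagrange-extrapolation instance] -/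
theorem prod_le_two_mul_E (hs : 0 < s) {D j : ℕ} (hj : 1 ≤ j) (hjD : j ≤ D) :
    ∏ i ∈ (Ico 1 (D + 1)).erase j, ((i : ℝ) ^ 2 + eps s) / |(i : ℝ) ^ 2 - (j : ℝ) ^ 2| ≤ 2 * E D s := by
  -- split each factor as `(i² / (|i-j|(i+j))) · (1 + ε/i²)`
  have hsplit : ∀ i ∈ (Ico 1 (D + 1)).erase j,
      ((i : ℝ) ^ 2 + eps s) / |(i : ℝ) ^ 2 - (j : ℝ) ^ 2| =
        ((i : ℝ) ^ 2 / ((Nat.dist i j : ℝ) * ((i : ℝ) + j))) * (1 + eps s / (i : ℝ) ^ 2) := by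
    intro i hi
    have hi1 : (1 : ℝ) ≤ i := by exact_mod_cast (mem_Ico.1 (mem_of_mem_erase hi)).1
    have hi0 : (i : ℝ) ≠ 0 := by positivity
    rw [abs_sq_sub_sq]
    field_simp
  rw [prod_congr rfl hsplit, prod_mul_distrib]
  -- the first product is `(∏ i)² / ∏ (|i-j|(i+j)) ≤ 2`
  have hQpos : ∀ i ∈ (Ico 1 (D + 1)).erase j, (0 : ℝ) < (Nat.dist i j : ℝ) * ((i : ℝ) + j) := by
    intro i hi
    obtain ⟨hij, hi'⟩ := mem_erase.1 hi
    have hi1 : 1 ≤ i := (mem_Ico.1 hi').1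
    have hd : 0 < Nat.dist i j := Nat.dist_pos_of_ne hij
    positivity
  have h1 : ∏ i ∈ (Ico 1 (D + 1)).erase j, (i : ℝ) ^ 2 / ((Nat.dist i j : ℝ) * ((i : ℝ) + j)) ≤ 2 := by
    rw [prod_div_distrib, div_le_iff₀ (prod_pos hQpos)]
    have h := prod_sq_le_two_mul hj hjD
    have h' : (((∏ i ∈ (Ico 1 (D + 1)).erase j, i) ^ 2 : ℕ) : ℝ) ≤
        ((2 * ∏ i ∈ (Ico 1 (D + 1)).erase j, (Nat.dist i j * (i + j)) : ℕ) : ℝ) := by exact_mod_cast h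
    push_cast at h'
    simpa [prod_pow] using h'
  have h2 : ∏ i ∈ (Ico 1 (D + 1)).erase j, (1 + eps s / (i : ℝ) ^ 2) ≤ E D s := by
    rw [E]
    have hmem : j ∈ Ico 1 (D + 1) := mem_Ico.2 ⟨hj, Nat.lt_succ_of_le hjD⟩
    rw [← mul_prod_erase (Ico 1 (D + 1)) _ hmem]
    exact le_mul_of_one_le_left (prod_nonneg fun i _ => (lt_of_lt_of_le one_pos (one_le_factor hs i)).le)
      (one_le_factor hs j)
  calc _ ≤ 2 * ∏ i ∈ (Ico 1 (D + 1)).erase j, (1 + eps s / (i : ℝ) ^ 2) :=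
        mul_le_mul_of_nonneg_right h1
          (prod_nonneg fun i _ => (lt_of_lt_of_le one_pos (one_le_factor hs i)).le)
    _ ≤ 2 * E D s := by gcongr

/-- `Σ_{1 ≤ i ≤ D} 1/i² ≤ 7/4`.
[cite: CoppersmithRivlin1992, Thm. (p. 970); elementary Lagrange-extrapolation instance] -/
theorem sum_inv_sq_le (D : ℕ) : ∑ i ∈ Ico 1 (D + 1), (1 : ℝ) / (i : ℝ) ^ 2 ≤ 7 / 4 := by
  -- stronger: `≤ 7/4 - 1/D` for `D ≥ 2`
  have key : ∀ D : ℕ, 2 ≤ D → ∑ i ∈ Ico 1 (D + 1), (1 : ℝ) / (i : ℝ) ^ 2 ≤ 7 / 4 - 1 / D := by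
    intro D hD
    induction D with
    | zero => omega
    | succ D ih =>
      rcases Nat.lt_or_ge D 2 with hD2 | hD2
      · interval_cases D
        · omega
        · rw [show Ico 1 (1 + 1 + 1) = {1, 2} by rfl, sum_pair (by norm_num)]
          norm_num
      · rw [sum_Ico_succ_top (by omega), Nat.cast_succ]
        have hD0 : (0 : ℝ) < D := by exact_mod_cast (by omega : 0 < D)
        have hstep : (1 : ℝ) / ((D : ℝ) + 1) ^ 2 ≤ 1 / D - 1 / (D + 1) := by
          rw [div_sub_div _ _ hD0.ne' (by positivity), div_le_div_iff₀ (by positivity) (by positivity)]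
          nlinarith
        linarith [ih hD2]
  rcases Nat.lt_or_ge D 2 with hD | hD
  · interval_cases D
    · norm_num
    · rw [show Ico 1 (1 + 1) = {1} by rfl, sum_singleton]; norm_num
  · have hD0 : (0 : ℝ) < D := by exact_mod_cast (by omega : 0 < D)
    have := key D hD
    have : (0 : ℝ) < 1 / D := by positivity
    linarith

/-- `E ≤ exp (7ε/4)`.
[cite: CoppersmithRivlin1992, Thm. (p. 970); elementary Lagrange-extrapolation instance] -/
theorem E_le_exp (hs : 0 < s) (D : ℕ) : E D s ≤ Real.exp (7 / 4 * eps s) := by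
  calc E D s ≤ ∏ i ∈ Ico 1 (D + 1), Real.exp (eps s / (i : ℝ) ^ 2) := by
        refine prod_le_prod (fun i _ => (lt_of_lt_of_le one_pos (one_le_factor hs i)).le) fun i _ => ?_
        rw [add_comm]; exact Real.add_one_le_exp _
    _ = Real.exp (∑ i ∈ Ico 1 (D + 1), eps s / (i : ℝ) ^ 2) := (Real.exp_sum _ _).symm
    _ ≤ Real.exp (7 / 4 * eps s) := by
        rw [Real.exp_le_exp]
        have h := sum_inv_sq_le D
        calc ∑ i ∈ Ico 1 (D + 1), eps s / (i : ℝ) ^ 2 = eps s * ∑ i ∈ Ico 1 (D + 1), 1 / (i : ℝ) ^ 2 := by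
              rw [mul_sum]; exact sum_congr rfl fun i _ => by rw [mul_one_div]
          _ ≤ eps s * (7 / 4) := by gcongr; exact (eps_pos hs).le
          _ = 7 / 4 * eps s := mul_comm _ _

/-- `exp (21/16) < 4`.
[cite: CoppersmithRivlin1992, Thm. (p. 970); elementary Lagrange-extrapolation instance] -/
theorem exp_bound : Real.exp (21 / 16) < 4 := by
  have h1 := Real.exp_one_lt_d9
  have h2 : Real.exp (5 / 16) < 1 / (1 - 5 / 16) :=
    Real.exp_bound_div_one_sub_of_interval' (by norm_num) (by norm_num)
  rw [show (21 : ℝ) / 16 = 1 + 5 / 16 by norm_num, Real.exp_add]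
  calc Real.exp 1 * Real.exp (5 / 16) < 2.7182818286 * (1 / (1 - 5 / 16)) :=
        mul_lt_mul'' h1 h2 (Real.exp_pos _).le (Real.exp_pos _).le
    _ < 4 := by norm_num

/-- **The variation bound**: `Σ_{j ≤ D} L_j ≤ 20` for `s ≥ 1`.
[cite: CoppersmithRivlin1992, Thm. (p. 970); elementary Lagrange-extrapolation instance] -/
theorem sum_L_le (hs : 1 ≤ s) (D : ℕ) : ∑ j ∈ range (D + 1), L D s j ≤ 20 := by
  have hs0 : 0 < s := by linarith
  have hε := eps_pos hs0
  have hε' := eps_le hs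
  have hE := E_pos hs0 D
  -- split off `j = 0`
  have h0 : range (D + 1) = insert 0 (Ico 1 (D + 1)) := by
    ext i; simp only [mem_range, mem_insert, mem_Ico]; omega
  rw [h0, sum_insert (by simp), L_zero hs0]
  have hj : ∀ j ∈ Ico 1 (D + 1), L D s j ≤ 2 * E D s * (eps s / (j : ℝ) ^ 2) := by
    intro j hjm
    obtain ⟨hj1, hjD⟩ := mem_Ico.1 hjm
    rw [L_succ hs0 hj1 (by omega)]
    have := prod_le_two_mul_E hs0 hj1 (by omega : j ≤ D)
    have hε2 : 0 ≤ eps s / (j : ℝ) ^ 2 := by positivity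
    nlinarith
  have hsum : ∑ j ∈ Ico 1 (D + 1), L D s j ≤ 2 * E D s * (eps s * (7 / 4)) := by
    calc ∑ j ∈ Ico 1 (D + 1), L D s j ≤ ∑ j ∈ Ico 1 (D + 1), 2 * E D s * (eps s / (j : ℝ) ^ 2) :=
          sum_le_sum hj
      _ = 2 * E D s * (eps s * ∑ j ∈ Ico 1 (D + 1), 1 / (j : ℝ) ^ 2) := by
          rw [← mul_sum, mul_sum (s := Ico 1 (D + 1)) (fun j => 1 / (j : ℝ) ^ 2) (eps s)]
          congr 1; exact sum_congr rfl fun j _ => by rw [mul_one_div]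
      _ ≤ 2 * E D s * (eps s * (7 / 4)) := by gcongr; exact sum_inv_sq_le D
  -- numerics
  have hexp : E D s ≤ Real.exp (21 / 16) :=
    (E_le_exp hs0 D).trans (Real.exp_le_exp.2 (by linarith))
  have h4 := exp_bound
  nlinarith

end Real


/-! ### Lagrange extrapolation to the virtual level `0` -/

section Lagrange

variable {s : ℝ}

/-- The nodes increase.
[cite: CoppersmithRivlin1992, Thm. (p. 970); elementary Lagrange-extrapolation instance] -/
theorem node_strictMono (hs : 0 < s) : StrictMono (node s) := by
  intro i j hij
  have h : (i : ℝ) < j := by exact_mod_cast hij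
  have hi : (0 : ℝ) ≤ i := by positivity
  have h2 : (i : ℝ) ^ 2 < (j : ℝ) ^ 2 := by nlinarith
  rw [node, node]
  nlinarith

/-- The nodes are distinct.
[cite: CoppersmithRivlin1992, Thm. (p. 970); elementary Lagrange-extrapolation instance] -/
theorem node_injective (hs : 0 < s) : Function.Injective (node s) := (node_strictMono hs).injective

/-- `basisDivisor x y` at `0`.
[cite: CoppersmithRivlin1992, Thm. (p. 970); elementary Lagrange-extrapolation instance] -/
theorem eval_zero_basisDivisor (x y : ℝ) : (Lagrange.basisDivisor x y).eval 0 = (x - y)⁻¹ * (0 - y) := by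
  simp [Lagrange.basisDivisor]

/-- `|ℓ_j(0)| = L_j`.
[cite: CoppersmithRivlin1992, Thm. (p. 970); elementary Lagrange-extrapolation instance] -/
theorem abs_eval_zero_basis (hs : 0 < s) (D j : ℕ) :
    |(Lagrange.basis (range (D + 1)) (node s) j).eval 0| = L D s j := by
  rw [Lagrange.basis, eval_prod, Finset.abs_prod, L]
  refine prod_congr rfl fun i _ => ?_
  rw [eval_zero_basisDivisor, zero_sub, abs_mul, abs_neg, abs_inv, abs_of_pos (node_pos hs i),
    abs_sub_comm, inv_mul_eq_div]

/-- **Lagrange extrapolation**: `p(0) = Σ_j p(v_j) ℓ_j(0)` for `deg p ≤ D`.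
[cite: CoppersmithRivlin1992, Thm. (p. 970); elementary Lagrange-extrapolation instance] -/
theorem sum_eval_mul_basis (hs : 0 < s) (D : ℕ) (p : ℝ[X]) (hp : p.natDegree ≤ D) :
    ∑ j ∈ range (D + 1), p.eval (node s j) * (Lagrange.basis (range (D + 1)) (node s) j).eval 0 =
      p.eval 0 := by
  have hinj : Set.InjOn (node s) (range (D + 1) : Finset ℕ) := (node_injective hs).injOn
  have hdeg : p.degree < (range (D + 1)).card := by
    rw [card_range]
    exact degree_le_natDegree.trans_lt (by exact_mod_cast Nat.lt_succ_of_le hp)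
  have h := Lagrange.eq_interpolate hinj hdeg
  conv_rhs => rw [h]
  rw [Lagrange.interpolate_apply, eval_finsetSum]
  simp only [eval_mul, eval_C]

end Lagrange

/-! ### The design -/

section Design

/-- The integer node `3 + 4 S i²`.
[cite: CoppersmithRivlin1992, Thm. (p. 970); elementary Lagrange-extrapolation instance] -/
def nodeN (S i : ℕ) : ℕ := 3 + 4 * S * i ^ 2

/-- Its explicit inverse.
[cite: CoppersmithRivlin1992, Thm. (p. 970); elementary Lagrange-extrapolation instance] -/
def idx (S c : ℕ) : ℕ := Nat.sqrt ((c - 3) / (4 * S))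

/-- The integer node casts to the real node.
[cite: CoppersmithRivlin1992, Thm. (p. 970); elementary Lagrange-extrapolation instance] -/
theorem cast_nodeN (S i : ℕ) : (nodeN S i : ℝ) = node (S : ℝ) i := by
  simp [nodeN, node]

/-- `idx` inverts `nodeN`.
[cite: CoppersmithRivlin1992, Thm. (p. 970); elementary Lagrange-extrapolation instance] -/
theorem idx_nodeN {S : ℕ} (hS : 1 ≤ S) (i : ℕ) : idx S (nodeN S i) = i := by
  rw [idx, nodeN, Nat.add_sub_cancel_left, show 4 * S * i ^ 2 = i ^ 2 * (4 * S) by ring,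
    Nat.mul_div_cancel _ (by omega), sq, Nat.sqrt_eq]

/-- The integer nodes are distinct.
[cite: CoppersmithRivlin1992, Thm. (p. 970); elementary Lagrange-extrapolation instance] -/
theorem nodeN_injective {S : ℕ} (hS : 1 ≤ S) : Function.Injective (nodeN S) :=
  Function.LeftInverse.injective (idx_nodeN hS)

/-- The integer nodes are odd.
[cite: CoppersmithRivlin1992, Thm. (p. 970); elementary Lagrange-extrapolation instance] -/
theorem odd_nodeN (S i : ℕ) : Odd (nodeN S i) :=
  ⟨1 + 2 * S * i ^ 2, by rw [nodeN]; ring⟩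

/-- The weights: `w_c = -ℓ_{idx c}(0)` (only the values on the nodes matter).
[cite: CoppersmithRivlin1992, Thm. (p. 970); elementary Lagrange-extrapolation instance] -/
def weight (D S : ℕ) (c : ℕ) : ℝ :=
  -(Lagrange.basis (range (D + 1)) (node (S : ℝ)) (idx S c)).eval 0

/-- The node set.
[cite: CoppersmithRivlin1992, Thm. (p. 970); elementary Lagrange-extrapolation instance] -/
def nodes (D S : ℕ) : Finset ℕ := (range (D + 1)).image (nodeN S)

/-- Sums over the node set are sums over `j ≤ D`.
[cite: CoppersmithRivlin1992, Thm. (p. 970); elementary Lagrange-extrapolation instance] -/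
theorem sum_nodes {D S : ℕ} (hS : 1 ≤ S) (g : ℕ → ℝ) :
    ∑ c ∈ nodes D S, weight D S c * g c =
      ∑ j ∈ range (D + 1), -(Lagrange.basis (range (D + 1)) (node (S : ℝ)) j).eval 0 * g (nodeN S j) := by
  rw [nodes, sum_image fun i _ j _ h => nodeN_injective hS h]
  refine sum_congr rfl fun j _ => ?_
  rw [weight, idx_nodeN hS]

/-- Exactness at the virtual level.
[cite: CoppersmithRivlin1992, Thm. (p. 970); elementary Lagrange-extrapolation instance] -/
theorem exact {D S : ℕ} (hS : 1 ≤ S) (p : ℝ[X]) (hp : p.natDegree ≤ D) :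
    ∑ c ∈ nodes D S, weight D S c * p.eval (c : ℝ) = -p.eval 0 := by
  have hs : (0 : ℝ) < S := by exact_mod_cast hS
  rw [sum_nodes hS, ← sum_eval_mul_basis hs D p hp, ← sum_neg_distrib]
  refine sum_congr rfl fun j _ => ?_
  rw [cast_nodeN]; ring

/-- Normalisation.
[cite: CoppersmithRivlin1992, Thm. (p. 970); elementary Lagrange-extrapolation instance] -/
theorem normalised {D S : ℕ} (hS : 1 ≤ S) (hD : 1 ≤ D) :
    ∑ c ∈ nodes D S, weight D S c * ((c : ℝ) - 1) = 1 := by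
  have h := exact hS (X - C 1 : ℝ[X]) ((natDegree_sub_le _ _).trans (by simp; omega))
  simp only [eval_sub, eval_X, eval_C] at h
  rw [h]; norm_num

/-- Variation.
[cite: CoppersmithRivlin1992, Thm. (p. 970); elementary Lagrange-extrapolation instance] -/
theorem variation {D S : ℕ} (hS : 1 ≤ S) : ∑ c ∈ nodes D S, |weight D S c| ≤ 20 := by
  have hs : (1 : ℝ) ≤ S := by exact_mod_cast hS
  rw [nodes, sum_image fun i _ j _ h => nodeN_injective hS h]
  calc ∑ j ∈ range (D + 1), |weight D S (nodeN S j)| = ∑ j ∈ range (D + 1), L D (S : ℝ) j := by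
        refine sum_congr rfl fun j _ => ?_
        rw [weight, idx_nodeN hS, abs_neg, abs_eval_zero_basis (by linarith)]
    _ ≤ 20 := sum_L_le hs D

end Design

/-! ### Arithmetic of the parameters -/

section Params

open Literature.Barriers.PneNP

/-- The cut size: the odd one of `n/2 - 1`, `n/2 - 2`.
[cite: CoppersmithRivlin1992, Thm. (p. 970); elementary Lagrange-extrapolation instance] -/
def tOf (n : ℕ) : ℕ := if n % 4 = 0 then n / 2 - 1 else n / 2 - 2

/-- `t` is odd, `2t + 2 ≤ n ≤ 4t`, and `n/2 ≤ t + 2` (`n ≥ 100` even).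
[cite: CoppersmithRivlin1992, Thm. (p. 970); elementary Lagrange-extrapolation instance] -/
theorem tOf_spec {n : ℕ} (hn : 100 ≤ n) (he : Even n) :
    Odd (tOf n) ∧ 2 * tOf n + 2 ≤ n ∧ n ≤ 4 * tOf n ∧ n / 2 ≤ tOf n + 2 := by
  obtain ⟨k, rfl⟩ := he
  rw [tOf, Nat.odd_iff]
  split_ifs with h <;> omega

/-- `⌊√n⌋ ≥ 10` for `n ≥ 100`.
[cite: CoppersmithRivlin1992, Thm. (p. 970); elementary Lagrange-extrapolation instance] -/
theorem sqrt_ge {n : ℕ} (hn : 100 ≤ n) : 10 ≤ Nat.sqrt n :=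
  Nat.le_sqrt.2 (le_trans (by norm_num) hn)

/-- `T(n) ≤ t` for `n ≥ 100`.
[cite: CoppersmithRivlin1992, Thm. (p. 970); elementary Lagrange-extrapolation instance] -/
theorem Tq_le_tOf {n : ℕ} (hn : 100 ≤ n) (he : Even n) : Tq n ≤ tOf n := by
  have hq := sqrt_ge hn
  have hqq : Nat.sqrt n * Nat.sqrt n ≤ n := Nat.sqrt_le n
  have h8 : 8 * Nat.sqrt n + 10 ≤ n := by nlinarith
  have ht := (tOf_spec hn he).2.2.2
  rw [Tq]
  omega

/-- `D(n) ≥ 1` for `n ≥ 100`.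
[cite: CoppersmithRivlin1992, Thm. (p. 970); elementary Lagrange-extrapolation instance] -/
theorem dq_pos {n : ℕ} (hn : 100 ≤ n) : 1 ≤ dq n := by
  rw [dq]; exact Nat.le_sqrt.2 (le_trans (by norm_num) (sqrt_ge hn))

/-- `s = ⌊√n⌋ / D² ≥ 1` and `s D² ≤ ⌊√n⌋`.
[cite: CoppersmithRivlin1992, Thm. (p. 970); elementary Lagrange-extrapolation instance] -/
def sOf (n : ℕ) : ℕ := Nat.sqrt n / (dq n * dq n)

/-- `s ≥ 1`.
[cite: CoppersmithRivlin1992, Thm. (p. 970); elementary Lagrange-extrapolation instance] -/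
theorem sOf_pos {n : ℕ} (hn : 100 ≤ n) : 1 ≤ sOf n := by
  rw [sOf, Nat.one_le_div_iff (Nat.mul_pos (dq_pos hn) (dq_pos hn)), dq]
  exact Nat.sqrt_le _

/-- The nodes lie below `T(n)`.
[cite: CoppersmithRivlin1992, Thm. (p. 970); elementary Lagrange-extrapolation instance] -/
theorem nodeN_le_Tq {n : ℕ} (j : ℕ) (hj : j ≤ dq n) : nodeN (sOf n) j ≤ Tq n := by
  rw [nodeN, Tq]
  have h1 : sOf n * (dq n * dq n) ≤ Nat.sqrt n := Nat.div_mul_le_self _ _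
  have h2 : j ^ 2 ≤ dq n * dq n := by rw [sq]; exact Nat.mul_le_mul hj hj
  nlinarith

end Params

end ChebyshevDesign

open ChebyshevDesign Literature.Barriers.PneNP in
/-- **A balanced exact extrapolation design of variation `≤ 20` exists for every even `n ≥ 100`**
(Lagrange extrapolation from the quadratically spaced odd levels `3 + 4 s j²`, `j ≤ dq n`, to the
virtual level `0`; the cell's crux `ChebyshevDesign20`). Proves the named statement
`ChebyshevDesignExistsBal 20`. [cite: CoppersmithRivlin1992, Thm. (p. 970)] -/
theorem chebyshevDesignExistsBal_twenty : ChebyshevDesignExistsBal 20 := by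
  refine ⟨100, fun n hn he => ⟨tOf n, nodes (dq n) (sOf n), weight (dq n) (sOf n), ?_, (tOf_spec hn he).2.2.1⟩⟩
  obtain ⟨hodd, h2t, -, -⟩ := tOf_spec hn he
  have hS := sOf_pos hn
  refine ⟨hodd, h2t, Tq_le_tOf hn he, ?_, normalised hS (dq_pos hn), fun p hp => exact hS p hp, variation hS⟩
  intro c hc
  obtain ⟨j, hj, rfl⟩ := mem_image.1 hc
  have hjD : j ≤ dq n := Nat.lt_succ_iff.1 (mem_range.1 hj)
  have hle : nodeN (sOf n) j ≤ Tq n := nodeN_le_Tq j hjD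
  refine ⟨odd_nodeN _ _, by rw [nodeN]; omega, hle, ?_⟩
  exact qset_nonempty_of_two_mul_add_two_le he hodd h2t (odd_nodeN _ _) (hle.trans (Tq_le_tOf hn he))

end Literature.Combinatorics.Optimization
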